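import Summits.QuantumFields.YangMills.Theorems.UnitScaleTiltProp7HermiteFold
import HarnessLib

/-!
# Route `UnitScaleTilt`, crux K1 «MinimiserStabilityRegPr» (stmt-QuantumFields-19200), route-R E′ path (α′), row LEMMA-H-CURVED — FILE 2c(i):
# SECOND-DIFFERENCE ROWS OF THE HERMITE FOLD: one factor at `x, x ± e_μ` on a run-constant argument, `|Δ²_μ(H_μw)| ≤ (6∕ℓ²)(|δ⁺w| + |δ⁻w|)`, and the square sum
# `Σ_x (Δ²_μ Hg)(x)² ≤ (144∕ℓ⁴)·Σ_x (g(x + ℓe_μ) − g(x))²` for run-constant `g` (FILE 2c(i); the extension theorem is FILE 2c(ii) ✓ `Prop7HermiteInterpolation`)`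

Cell `ym3-torus`, D-0154 (3c) twin-width seat `ym-routeR-w1` (gen 5); row «routeR-w1 g5: LEMMA-H-CURVED» (namer ★ym-ust-19200-p1 g14, 2026-08-28 17:33Z; «F-H2 GO» 17:48Z).
THEOREMS ONLY (0 `def`, 0 `sorry`); `--supports stmt-QuantumFields-19200`, count-neutral.  YM₃ on T³ is a ladder rung (R3), not the Clay problem; nothing here claims a stub, the
crux, d = 4 or the mass gap.

WHY.  LEMMA-H-curved ⟸ biharmonic Dirichlet principle (✓ `Prop7CentreBiharmonicDirichlet`, F-H1) + ONE explicit extension of the centre data with Laplacian energy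
`O(ℓ⁻¹·Σ_c|δ_c f|²)` (d = 3).  THIS FILE completes the FLAT extension: `φ = H(f ∘ B^k(· − h𝟙))`, `H` the Hermite fold of ✓ `Prop7HermiteFold` with the C¹ profile of
✓ `Prop7HermiteProfile` (kept ABSTRACT as `p` with its displayed rows until the last theorem).  Per direction `μ`: pull `H_μ` out of the fold (`Φ = H_μF`, `F` the fold over
the other directions, constant along the `μ`-runs); the three values `H_μF(x ± e_μ), H_μF(x)` are blends of `F(x)` and `F(x ± ℓe_μ)` with the profile at offsets `r ± 1, r`
(§1: interior `Δ²_μ = (p(r+1) − 2p(r) + p(r−1))·(F(x) − F(x+ℓe_μ))`, knot `Δ²_μ = p(ℓ−1)·(F(x+ℓe_μ) − 2F(x) + F(x−ℓe_μ))`), so `|Δ²_μΦ(x)| ≤ (6∕ℓ²)(|F(x+ℓe_μ) − F(x)| + |F(x) − F(x−ℓe_μ)|)`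
(§2); the long differences of `F` are folds of the long difference `δ⁺g = g(· + ℓe_μ) − g` (translations in direction `μ` commute with the other factors), convexity gives
`(Δ²_μΦ)² ≤ (72∕ℓ⁴)·(H'((δ⁺g)²)(x) + H'((δ⁺g)²)(x − ℓe_μ))` and EXACT MASS PRESERVATION sums it to `(144∕ℓ⁴)·Σ_x (g(x+ℓe_μ) − g(x))² = 144·ℓ^(d−4)·Σ_y (f(y+e_μ) − f(y))²` (§3, the
fibre count of ✓ `Prop7TentInterpolation`).  Summing the directions with `(Σ_μ a_μ)² ≤ d·Σa_μ²` gives the Laplacian row and §4 instantiates the profile: ★★★ `exists_hermiteInterpolant`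
in the letters of the ENGINE's `hH` (`laplace 1`, `embIter k`).
WHAT THIS GIVES.  Together with F-H1 (flat reading) a constructive flat LEMMA H (`C_H = 432·(...)` vs the Fourier `3π⁴∕4` of ✓ `lemmaH_flat`) — not needed by the flat engine; its
PURPOSE is F-H3: the same weights, transported along `W`, give the curved extension (curvature enters only through the transports).
HONEST SCOPE.  Flat, real-valued, linear; the profile rows are ✓ `Prop7HermiteProfile`; nothing curved, nothing of Bałaban's beyond the cited letters.

References: T. Bałaban, CMP 95 (1984) 17–40 [Balaban1984PropagatorsI] ((1.18) p.20, (1.29)–(1.31) p.23); CMP 102 (1985) 277–309 [Balaban1985Variational] (Prop. 7 p.299).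
-/

set_option autoImplicit false

noncomputable section

open scoped BigOperators

namespace Summit.QuantumFields.YangMills.Theorems.Prop7HermiteSecondDiff

open Literature.MathematicalPhysics.QuantumFieldTheory.Balaban1983to89
open Finset
open Summit.QuantumFields.YangMills.Theorems.Prop7TentInterpolation (sum_translate shift_eq_update update_update_add iterBlockOf_update_pow sum_comp_iterBlockOf)
open Summit.QuantumFields.YangMills.Theorems.Prop7HermiteOffsets (offset_lt offset_add_ell offset_shift offset_unshift corner_shift_of_lt corner_shift_of_eq
  corner_unshift_of_pos corner_unshift_of_zero corner_add_ell offset_update_ne)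
open Summit.QuantumFields.YangMills.Theorems.Prop7HermiteFold (update_comm_abs foldr_translate foldr_add foldr_sub foldr_smul foldr_eq_hermStep_erase foldr_abs_le foldr_sq_le
  foldr_mono runConst_foldr sum_foldr_eq foldr_embIter)
open B5Eq118OneStroke (iterBlockOf val_iterBlockOf)
open B15DeterminingSets (embIter)

variable {P : Params}

/-! ## §1 One Hermite factor at the three points `x − e_μ, x, x + e_μ` for a run-constant argument -/

section OneFactor

variable (ℓ : ℕ) (h : ZMod (P.sitesPerDir 0)) (p : ℕ → ℝ)

/-- the upper centre line is the `ℓ`-translate of the lower one. [folklore] -/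
theorem cornerL_eq (x : Site P 0) (μ : Fin P.d) :
    Function.update x μ (x μ - ((((x μ - h).val % ℓ : ℕ)) : ZMod (P.sitesPerDir 0)) + ((ℓ : ℕ) : ZMod (P.sitesPerDir 0))) = Function.update (Function.update x μ (x μ - ((((x μ - h).val % ℓ : ℕ)) : ZMod (P.sitesPerDir 0)))) μ ((Function.update x μ (x μ - ((((x μ - h).val % ℓ : ℕ)) : ZMod (P.sitesPerDir 0)))) μ + ((ℓ : ℕ) : ZMod (P.sitesPerDir 0))) := by
  funext κ
  by_cases hκ : κ = μ
  · subst hκ; simp only [Function.update_self]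
  · simp only [Function.update_of_ne hκ]

/-- for a `μ`-run-constant `w`: `w(x⌊μ⌋) = w(x)` and `w(x⌊μ⌋ + ℓe_μ) = w(x + ℓe_μ)`. [folklore] -/
theorem runConst_values (hℓN : ℓ ∣ P.sitesPerDir 0) (μ : Fin P.d) (w : Site P 0 → ℝ)
    (hw : ∀ x : Site P 0, w x = w (Function.update x μ (x μ - ((((x μ - h).val % ℓ : ℕ)) : ZMod (P.sitesPerDir 0))))) (x : Site P 0) :
    w (Function.update x μ (x μ - ((((x μ - h).val % ℓ : ℕ)) : ZMod (P.sitesPerDir 0)))) = w x ∧ w (Function.update x μ (x μ - ((((x μ - h).val % ℓ : ℕ)) : ZMod (P.sitesPerDir 0)) + ((ℓ : ℕ) : ZMod (P.sitesPerDir 0)))) = w (Function.update x μ (x μ + ((ℓ : ℕ) : ZMod (P.sitesPerDir 0)))) := by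
  refine ⟨(hw x).symm, ?_⟩
  rw [hw (Function.update x μ (x μ + ((ℓ : ℕ) : ZMod (P.sitesPerDir 0)))), corner_add_ell ℓ h hℓN]

/-- **THE FACTOR AT `x`**: `(H_μ w)(x) = p(r)·w(x) + (1 − p(r))·w(x + ℓe_μ)` for run-constant `w`. [folklore] -/
theorem hermStep_self_eq (hℓN : ℓ ∣ P.sitesPerDir 0) (μ : Fin P.d) (w : Site P 0 → ℝ)
    (hw : ∀ x : Site P 0, w x = w (Function.update x μ (x μ - ((((x μ - h).val % ℓ : ℕ)) : ZMod (P.sitesPerDir 0))))) (x : Site P 0) :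
    (p ((x μ - h).val % ℓ) * w (Function.update x μ (x μ - ((((x μ - h).val % ℓ : ℕ)) : ZMod (P.sitesPerDir 0)))) + (1 - p ((x μ - h).val % ℓ)) * w (Function.update x μ (x μ - ((((x μ - h).val % ℓ : ℕ)) : ZMod (P.sitesPerDir 0)) + ((ℓ : ℕ) : ZMod (P.sitesPerDir 0))))) = p ((x μ - h).val % ℓ) * w x + (1 - p ((x μ - h).val % ℓ)) * w (Function.update x μ (x μ + ((ℓ : ℕ) : ZMod (P.sitesPerDir 0)))) := by
  obtain ⟨h1, h2⟩ := runConst_values ℓ h hℓN μ w hw x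
  rw [h1, h2]

/-- **THE FACTOR AT `x + e_μ`**: `(H_μ w)(x + e_μ) = p(r+1)·w(x) + (1 − p(r+1))·w(x + ℓe_μ)` (interior: same cell; knot `r + 1 = ℓ`: the value is `w(x + ℓe_μ)` and
`p(ℓ) = 0`). [folklore] -/
theorem hermStep_shift_eq (hℓN : ℓ ∣ P.sitesPerDir 0) (hℓ : 0 < ℓ) (hp0 : p 0 = 1) (hpℓ : p ℓ = 0) (μ : Fin P.d) (w : Site P 0 → ℝ)
    (hw : ∀ x : Site P 0, w x = w (Function.update x μ (x μ - ((((x μ - h).val % ℓ : ℕ)) : ZMod (P.sitesPerDir 0))))) (x : Site P 0) :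
    (p (((x.shift μ) μ - h).val % ℓ) * w (Function.update (x.shift μ) μ ((x.shift μ) μ - (((((x.shift μ) μ - h).val % ℓ : ℕ)) : ZMod (P.sitesPerDir 0)))) + (1 - p (((x.shift μ) μ - h).val % ℓ)) * w (Function.update (x.shift μ) μ ((x.shift μ) μ - (((((x.shift μ) μ - h).val % ℓ : ℕ)) : ZMod (P.sitesPerDir 0)) + ((ℓ : ℕ) : ZMod (P.sitesPerDir 0))))) = p ((x μ - h).val % ℓ + 1) * w x + (1 - p ((x μ - h).val % ℓ + 1)) * w (Function.update x μ (x μ + ((ℓ : ℕ) : ZMod (P.sitesPerDir 0)))) := by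
  obtain ⟨h1, h2⟩ := runConst_values ℓ h hℓN μ w hw x
  have hlt : (x μ - h).val % ℓ < ℓ := Nat.mod_lt _ hℓ
  rcases Nat.lt_or_ge ((x μ - h).val % ℓ + 1) ℓ with hr | hr
  · have hcL : Function.update (x.shift μ) μ ((x.shift μ) μ - (((((x.shift μ) μ - h).val % ℓ : ℕ)) : ZMod (P.sitesPerDir 0)) + ((ℓ : ℕ) : ZMod (P.sitesPerDir 0))) = Function.update x μ (x μ - ((((x μ - h).val % ℓ : ℕ)) : ZMod (P.sitesPerDir 0)) + ((ℓ : ℕ) : ZMod (P.sitesPerDir 0))) := by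
      rw [cornerL_eq ℓ h (x.shift μ) μ, corner_shift_of_lt ℓ h hℓN x μ hr, ← cornerL_eq ℓ h x μ]
    rw [hcL, corner_shift_of_lt ℓ h hℓN x μ hr, offset_shift ℓ h hℓN, Nat.mod_eq_of_lt hr, h1, h2]
  · have hr' : (x μ - h).val % ℓ + 1 = ℓ := le_antisymm hlt hr
    have hoff : ((x.shift μ) μ - h).val % ℓ = 0 := by rw [offset_shift ℓ h hℓN, hr', Nat.mod_self]
    have hcL : Function.update (x.shift μ) μ ((x.shift μ) μ - (((((x.shift μ) μ - h).val % ℓ : ℕ)) : ZMod (P.sitesPerDir 0)) + ((ℓ : ℕ) : ZMod (P.sitesPerDir 0))) = Function.update (Function.update x μ (x μ - ((((x μ - h).val % ℓ : ℕ)) : ZMod (P.sitesPerDir 0)) + ((ℓ : ℕ) : ZMod (P.sitesPerDir 0)))) μ ((Function.update x μ (x μ - ((((x μ - h).val % ℓ : ℕ)) : ZMod (P.sitesPerDir 0)) + ((ℓ : ℕ) : ZMod (P.sitesPerDir 0)))) μ + ((ℓ : ℕ) : ZMod (P.sitesPerDir 0))) := by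
      rw [cornerL_eq ℓ h (x.shift μ) μ, corner_shift_of_eq ℓ h hℓN x μ hr']
    rw [hcL, corner_shift_of_eq ℓ h hℓN x μ hr', hoff, hp0, hr', hpℓ, h2]
    ring

/-- **THE FACTOR AT `x − e_μ`, INTERIOR** (`r ≥ 1`): `(H_μ w)(x − e_μ) = p(r−1)·w(x) + (1 − p(r−1))·w(x + ℓe_μ)`. [folklore] -/
theorem hermStep_unshift_eq_of_pos (hℓN : ℓ ∣ P.sitesPerDir 0) (hℓ : 0 < ℓ) (μ : Fin P.d) (w : Site P 0 → ℝ)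
    (hw : ∀ x : Site P 0, w x = w (Function.update x μ (x μ - ((((x μ - h).val % ℓ : ℕ)) : ZMod (P.sitesPerDir 0))))) (x : Site P 0) (hr : 1 ≤ (x μ - h).val % ℓ) :
    (p (((x.unshift μ) μ - h).val % ℓ) * w (Function.update (x.unshift μ) μ ((x.unshift μ) μ - (((((x.unshift μ) μ - h).val % ℓ : ℕ)) : ZMod (P.sitesPerDir 0)))) + (1 - p (((x.unshift μ) μ - h).val % ℓ)) * w (Function.update (x.unshift μ) μ ((x.unshift μ) μ - (((((x.unshift μ) μ - h).val % ℓ : ℕ)) : ZMod (P.sitesPerDir 0)) + ((ℓ : ℕ) : ZMod (P.sitesPerDir 0))))) = p ((x μ - h).val % ℓ - 1) * w x + (1 - p ((x μ - h).val % ℓ - 1)) * w (Function.update x μ (x μ + ((ℓ : ℕ) : ZMod (P.sitesPerDir 0)))) := by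
  obtain ⟨h1, h2⟩ := runConst_values ℓ h hℓN μ w hw x
  have hlt : (x μ - h).val % ℓ < ℓ := Nat.mod_lt _ hℓ
  set r : ℕ := (x μ - h).val % ℓ with hrdef
  have hsum : r + (ℓ - 1) = (r - 1) + ℓ := by omega
  have hoff : ((x.unshift μ) μ - h).val % ℓ = r - 1 := by
    rw [offset_unshift ℓ h hℓN, ← hrdef, hsum, Nat.add_mod_right, Nat.mod_eq_of_lt (by omega)]
  have hcL : Function.update (x.unshift μ) μ ((x.unshift μ) μ - (((((x.unshift μ) μ - h).val % ℓ : ℕ)) : ZMod (P.sitesPerDir 0)) + ((ℓ : ℕ) : ZMod (P.sitesPerDir 0))) = Function.update x μ (x μ - ((((x μ - h).val % ℓ : ℕ)) : ZMod (P.sitesPerDir 0)) + ((ℓ : ℕ) : ZMod (P.sitesPerDir 0))) := by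
    rw [cornerL_eq ℓ h (x.unshift μ) μ, corner_unshift_of_pos ℓ h hℓN hℓ x μ hr, ← cornerL_eq ℓ h x μ]
  rw [hcL, corner_unshift_of_pos ℓ h hℓN hℓ x μ hr, hoff, ← hrdef, h1, h2]

/-- **THE FACTOR AT `x − e_μ`, KNOT** (`r = 0`): `(H_μ w)(x − e_μ) = p(ℓ−1)·w(x − ℓe_μ) + (1 − p(ℓ−1))·w(x)`. [folklore] -/
theorem hermStep_unshift_eq_of_zero (hℓN : ℓ ∣ P.sitesPerDir 0) (hℓ : 0 < ℓ) (μ : Fin P.d) (w : Site P 0 → ℝ) (x : Site P 0) (hr : (x μ - h).val % ℓ = 0) :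
    (p (((x.unshift μ) μ - h).val % ℓ) * w (Function.update (x.unshift μ) μ ((x.unshift μ) μ - (((((x.unshift μ) μ - h).val % ℓ : ℕ)) : ZMod (P.sitesPerDir 0)))) + (1 - p (((x.unshift μ) μ - h).val % ℓ)) * w (Function.update (x.unshift μ) μ ((x.unshift μ) μ - (((((x.unshift μ) μ - h).val % ℓ : ℕ)) : ZMod (P.sitesPerDir 0)) + ((ℓ : ℕ) : ZMod (P.sitesPerDir 0))))) = p (ℓ - 1) * w (Function.update x μ (x μ - ((ℓ : ℕ) : ZMod (P.sitesPerDir 0)))) + (1 - p (ℓ - 1)) * w x := by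
  have hoff : ((x.unshift μ) μ - h).val % ℓ = ℓ - 1 := by
    rw [offset_unshift ℓ h hℓN, hr, zero_add, Nat.mod_eq_of_lt (by omega)]
  have hc : Function.update (x.unshift μ) μ ((x.unshift μ) μ - (((((x.unshift μ) μ - h).val % ℓ : ℕ)) : ZMod (P.sitesPerDir 0))) = (Function.update x μ (x μ - ((ℓ : ℕ) : ZMod (P.sitesPerDir 0)))) := by
    rw [corner_unshift_of_zero ℓ h hℓN hℓ x μ hr, hr, Nat.cast_zero, sub_zero]
  have hcL : Function.update (x.unshift μ) μ ((x.unshift μ) μ - (((((x.unshift μ) μ - h).val % ℓ : ℕ)) : ZMod (P.sitesPerDir 0)) + ((ℓ : ℕ) : ZMod (P.sitesPerDir 0))) = x := by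
    rw [cornerL_eq ℓ h (x.unshift μ) μ, hc]
    funext κ
    by_cases hκ : κ = μ
    · subst hκ; simp only [Function.update_self]; ring
    · simp only [Function.update_of_ne hκ]
  rw [hcL, hc, hoff]

end OneFactor

/-! ## §2 The second difference of one factor: `≤ (6∕ℓ²)·(|w(x+ℓe_μ) − w(x)| + |w(x) − w(x−ℓe_μ)|)` -/

section SecondDiff

variable (ℓ : ℕ) (h : ZMod (P.sitesPerDir 0)) (p : ℕ → ℝ)

/-- ★ **SECOND DIFFERENCE OF ONE HERMITE FACTOR ON A RUN-CONSTANT ARGUMENT**: with the profile rows (`p(0) = 1`, `p(ℓ) = 0`, `|p(r+1) − 2p(r) + p(r−1)| ≤ 6∕ℓ²` for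
`1 ≤ r ≤ ℓ−1`, `p(1) + p(ℓ−1) = 1`, `0 ≤ p(ℓ−1) ≤ 3∕ℓ²`), `|(H_μw)(x+e_μ) − 2(H_μw)(x) + (H_μw)(x−e_μ)| ≤ (6∕ℓ²)·(|w(x+ℓe_μ) − w(x)| + |w(x) − w(x−ℓe_μ)|)`. [folklore] -/
theorem abs_secondDiff_hermStep_le (hℓN : ℓ ∣ P.sitesPerDir 0) (hℓ : 0 < ℓ) (hp0 : p 0 = 1) (hpℓ : p ℓ = 0)
    (hpD : ∀ r : ℕ, 1 ≤ r → r + 1 ≤ ℓ → |p (r + 1) - 2 * p r + p (r - 1)| ≤ 6 / (ℓ : ℝ) ^ 2)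
    (hpc : p 1 + p (ℓ - 1) = 1) (hpk0 : 0 ≤ p (ℓ - 1)) (hpk : p (ℓ - 1) ≤ 3 / (ℓ : ℝ) ^ 2)
    (μ : Fin P.d) (w : Site P 0 → ℝ) (hw : ∀ x : Site P 0, w x = w (Function.update x μ (x μ - ((((x μ - h).val % ℓ : ℕ)) : ZMod (P.sitesPerDir 0))))) (x : Site P 0) :
    |(p (((x.shift μ) μ - h).val % ℓ) * w (Function.update (x.shift μ) μ ((x.shift μ) μ - (((((x.shift μ) μ - h).val % ℓ : ℕ)) : ZMod (P.sitesPerDir 0)))) + (1 - p (((x.shift μ) μ - h).val % ℓ)) * w (Function.update (x.shift μ) μ ((x.shift μ) μ - (((((x.shift μ) μ - h).val % ℓ : ℕ)) : ZMod (P.sitesPerDir 0)) + ((ℓ : ℕ) : ZMod (P.sitesPerDir 0))))) - 2 * (p ((x μ - h).val % ℓ) * w (Function.update x μ (x μ - ((((x μ - h).val % ℓ : ℕ)) : ZMod (P.sitesPerDir 0)))) + (1 - p ((x μ - h).val % ℓ)) * w (Function.update x μ (x μ - ((((x μ - h).val % ℓ : ℕ)) : ZMod (P.sitesPerDir 0))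 + ((ℓ : ℕ) : ZMod (P.sitesPerDir 0))))) + (p (((x.unshift μ) μ - h).val % ℓ) * w (Function.update (x.unshift μ) μ ((x.unshift μ) μ - (((((x.unshift μ) μ - h).val % ℓ : ℕ)) : ZMod (P.sitesPerDir 0)))) + (1 - p (((x.unshift μ) μ - h).val % ℓ)) * w (Function.update (x.unshift μ) μ ((x.unshift μ) μ - (((((x.unshift μ) μ - h).val % ℓ : ℕ)) : ZMod (P.sitesPerDir 0)) + ((ℓ : ℕ) : ZMod (P.sitesPerDir 0)))))|
      ≤ 6 / (ℓ : ℝ) ^ 2 * (|w (Function.update x μ (x μ + ((ℓ : ℕ) : ZMod (P.sitesPerDir 0)))) - w x| + |w x - w (Function.update x μ (x μ - ((ℓ : ℕ) : ZMod (P.sitesPerDir 0))))|) := by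
  have hlt : (x μ - h).val % ℓ < ℓ := Nat.mod_lt _ hℓ
  have hA0 : 0 ≤ |w (Function.update x μ (x μ + ((ℓ : ℕ) : ZMod (P.sitesPerDir 0)))) - w x| := abs_nonneg _
  have hB0 : 0 ≤ |w x - w (Function.update x μ (x μ - ((ℓ : ℕ) : ZMod (P.sitesPerDir 0))))| := abs_nonneg _
  have hℓr : (0 : ℝ) < ℓ := by exact_mod_cast hℓ
  have h62 : (0 : ℝ) ≤ 6 / (ℓ : ℝ) ^ 2 := by positivity
  rw [hermStep_shift_eq ℓ h p hℓN hℓ hp0 hpℓ μ w hw x, hermStep_self_eq ℓ h p hℓN μ w hw x]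
  rcases Nat.eq_zero_or_pos ((x μ - h).val % ℓ) with hr | hr
  · -- knot `r = 0`
    rw [hermStep_unshift_eq_of_zero ℓ h p hℓN hℓ μ w x hr, hr, zero_add, hp0]
    have hp1 : p 1 = 1 - p (ℓ - 1) := by linarith
    rw [hp1]
    have e : (1 - p (ℓ - 1)) * w x + (1 - (1 - p (ℓ - 1))) * w (Function.update x μ (x μ + ((ℓ : ℕ) : ZMod (P.sitesPerDir 0)))) - 2 * (1 * w x + (1 - 1) * w (Function.update x μ (x μ + ((ℓ : ℕ) : ZMod (P.sitesPerDir 0)))))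
        + (p (ℓ - 1) * w (Function.update x μ (x μ - ((ℓ : ℕ) : ZMod (P.sitesPerDir 0)))) + (1 - p (ℓ - 1)) * w x)
        = p (ℓ - 1) * ((w (Function.update x μ (x μ + ((ℓ : ℕ) : ZMod (P.sitesPerDir 0)))) - w x) - (w x - w (Function.update x μ (x μ - ((ℓ : ℕ) : ZMod (P.sitesPerDir 0)))))) := by ring
    rw [e, abs_mul, abs_of_nonneg hpk0]
    have h36 : p (ℓ - 1) ≤ 6 / (ℓ : ℝ) ^ 2 := hpk.trans (by gcongr; norm_num)
    calc p (ℓ - 1) * |w (Function.update x μ (x μ + ((ℓ : ℕ) : ZMod (P.sitesPerDir 0)))) - w x - (w x - w (Function.update x μ (x μ - ((ℓ : ℕ) : ZMod (P.sitesPerDir 0)))))|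
        ≤ p (ℓ - 1) * (|w (Function.update x μ (x μ + ((ℓ : ℕ) : ZMod (P.sitesPerDir 0)))) - w x| + |w x - w (Function.update x μ (x μ - ((ℓ : ℕ) : ZMod (P.sitesPerDir 0))))|) := mul_le_mul_of_nonneg_left (abs_sub _ _) hpk0
      _ ≤ 6 / (ℓ : ℝ) ^ 2 * (|w (Function.update x μ (x μ + ((ℓ : ℕ) : ZMod (P.sitesPerDir 0)))) - w x| + |w x - w (Function.update x μ (x μ - ((ℓ : ℕ) : ZMod (P.sitesPerDir 0))))|) := mul_le_mul_of_nonneg_right h36 (by positivity)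
  · -- interior `1 ≤ r ≤ ℓ − 1`
    rw [hermStep_unshift_eq_of_pos ℓ h p hℓN hℓ μ w hw x hr]
    have e : p ((x μ - h).val % ℓ + 1) * w x + (1 - p ((x μ - h).val % ℓ + 1)) * w (Function.update x μ (x μ + ((ℓ : ℕ) : ZMod (P.sitesPerDir 0))))
        - 2 * (p ((x μ - h).val % ℓ) * w x + (1 - p ((x μ - h).val % ℓ)) * w (Function.update x μ (x μ + ((ℓ : ℕ) : ZMod (P.sitesPerDir 0)))))
        + (p ((x μ - h).val % ℓ - 1) * w x + (1 - p ((x μ - h).val % ℓ - 1)) * w (Function.update x μ (x μ + ((ℓ : ℕ) : ZMod (P.sitesPerDir 0)))))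
        = -((p ((x μ - h).val % ℓ + 1) - 2 * p ((x μ - h).val % ℓ) + p ((x μ - h).val % ℓ - 1)) * (w (Function.update x μ (x μ + ((ℓ : ℕ) : ZMod (P.sitesPerDir 0)))) - w x)) := by ring
    rw [e, abs_neg, abs_mul]
    calc |p ((x μ - h).val % ℓ + 1) - 2 * p ((x μ - h).val % ℓ) + p ((x μ - h).val % ℓ - 1)| * |w (Function.update x μ (x μ + ((ℓ : ℕ) : ZMod (P.sitesPerDir 0)))) - w x|
        ≤ 6 / (ℓ : ℝ) ^ 2 * |w (Function.update x μ (x μ + ((ℓ : ℕ) : ZMod (P.sitesPerDir 0)))) - w x| := mul_le_mul_of_nonneg_right (hpD _ hr (by omega)) hA0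
      _ ≤ 6 / (ℓ : ℝ) ^ 2 * (|w (Function.update x μ (x μ + ((ℓ : ℕ) : ZMod (P.sitesPerDir 0)))) - w x| + |w x - w (Function.update x μ (x μ - ((ℓ : ℕ) : ZMod (P.sitesPerDir 0))))|) := by nlinarith

end SecondDiff

/-! ## §3 The second difference of the full fold in one direction, and its square sum -/

section FoldDiff

variable (ℓ : ℕ) (h : ZMod (P.sitesPerDir 0)) (p : ℕ → ℝ)

/-- run-constancy in a direction `ν` passes to any function of `g(x)` and `g(x + a e_μ)` for `μ ≠ ν`. [folklore] -/
theorem runConst_pair {μ ν : Fin P.d} (hμν : μ ≠ ν) (g : Site P 0 → ℝ) (hg : ∀ x : Site P 0, g x = g (Function.update x ν (x ν - ((((x ν - h).val % ℓ : ℕ)) : ZMod (P.sitesPerDir 0)))))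
    (a : ZMod (P.sitesPerDir 0)) (Ψ : ℝ → ℝ → ℝ) (x : Site P 0) :
    Ψ (g (Function.update x μ (x μ + a))) (g x) = Ψ (g (Function.update (Function.update x ν (x ν - ((((x ν - h).val % ℓ : ℕ)) : ZMod (P.sitesPerDir 0)))) μ ((Function.update x ν (x ν - ((((x ν - h).val % ℓ : ℕ)) : ZMod (P.sitesPerDir 0)))) μ + a))) (g (Function.update x ν (x ν - ((((x ν - h).val % ℓ : ℕ)) : ZMod (P.sitesPerDir 0))))) := by
  rw [← hg x]
  congr 1
  rw [hg (Function.update x μ (x μ + a)), offset_update_ne ℓ h hμν x, Function.update_of_ne hμν.symm, Function.update_of_ne hμν,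
    update_comm_abs hμν.symm]

/-- ★★ **THE SQUARE SUM OF `Δ²_μ` OF THE HERMITE FOLD**: for `g` constant along the runs of every direction and the profile rows of §2,
`Σ_x ((Hg)(x+e_μ) − 2(Hg)(x) + (Hg)(x−e_μ))² ≤ (144∕ℓ⁴)·Σ_x (g(x + ℓe_μ) − g(x))²`. [folklore] -/
theorem sum_sq_secondDiff_foldr_le (hℓN : ℓ ∣ P.sitesPerDir 0) (hℓ : 0 < ℓ) (hp0 : p 0 = 1) (hpℓ : p ℓ = 0)
    (hp01 : ∀ r : ℕ, r < ℓ → 0 ≤ p r ∧ p r ≤ 1)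
    (hpD : ∀ r : ℕ, 1 ≤ r → r + 1 ≤ ℓ → |p (r + 1) - 2 * p r + p (r - 1)| ≤ 6 / (ℓ : ℝ) ^ 2)
    (hpc : p 1 + p (ℓ - 1) = 1) (hpk : p (ℓ - 1) ≤ 3 / (ℓ : ℝ) ^ 2)
    (g : Site P 0 → ℝ) (hg : ∀ ν : Fin P.d, ∀ x : Site P 0, g x = g (Function.update x ν (x ν - ((((x ν - h).val % ℓ : ℕ)) : ZMod (P.sitesPerDir 0))))) (μ : Fin P.d) :
    ∑ x : Site P 0, ((List.foldr (fun (μ : Fin P.d) (w : Site P 0 → ℝ) (x : Site P 0) => p ((x μ - h).val % ℓ) * w (Function.update x μ (x μ - ((((x μ - h).val % ℓ : ℕ)) : ZMod (P.sitesPerDir 0)))) + (1 - p ((x μ - h).val % ℓ)) * w (Function.update x μ (x μ - ((((x μ - h).val % ℓ : ℕ)) : ZMod (P.sitesPerDir 0)) + ((ℓ : ℕ) : ZMod (P.sitesPerDir 0))))) g (List.finRange P.d)) (x.shift μ) - 2 * (List.foldr (fun (μ : Fin P.d) (w : Site P 0 → ℝ) (x : Site P 0) => p ((x μ - h).val % ℓ)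 * w (Function.update x μ (x μ - ((((x μ - h).val % ℓ : ℕ)) : ZMod (P.sitesPerDir 0)))) + (1 - p ((x μ - h).val % ℓ)) * w (Function.update x μ (x μ - ((((x μ - h).val % ℓ : ℕ)) : ZMod (P.sitesPerDir 0)) + ((ℓ : ℕ) : ZMod (P.sitesPerDir 0))))) g (List.finRange P.d)) x + (List.foldr (fun (μ : Fin P.d) (w : Site P 0 → ℝ) (x : Site P 0) => p ((x μ - h).val % ℓ) * w (Function.update x μ (x μ - ((((x μ - h).val % ℓ : ℕ)) : ZMod (P.sitesPerDir 0)))) + (1 - p ((x μ - h).val % ℓ)) * w (Function.update x μ (x μ - ((((x μ - h).val % ℓ : ℕ)) : ZMod (P.sitesPerDir 0)) + ((ℓ : ℕ) : ZMod (P.sitesPerDir 0))))) g (List.finRange P.d)) (x.unshift μ)) ^ 2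
      ≤ 144 / (ℓ : ℝ) ^ 4 * ∑ x : Site P 0, (g (Function.update x μ (x μ + ((ℓ : ℕ) : ZMod (P.sitesPerDir 0)))) - g x) ^ 2 := by
  have hμ : μ ∈ List.finRange P.d := List.mem_finRange μ
  have hnd : (List.finRange P.d).Nodup := List.nodup_finRange P.d
  have hμe : μ ∉ (List.finRange P.d).erase μ := List.Nodup.not_mem_erase hnd
  have hnde : ((List.finRange P.d).erase μ).Nodup := hnd.erase μ
  have hpk0 : 0 ≤ p (ℓ - 1) := (hp01 _ (by omega)).1
  have hℓr : (0 : ℝ) < ℓ := by exact_mod_cast hℓ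
  -- `F` := the fold over the other directions is `μ`-run-constant
  have hF : ∀ x : Site P 0, (List.foldr (fun (μ : Fin P.d) (w : Site P 0 → ℝ) (x : Site P 0) => p ((x μ - h).val % ℓ) * w (Function.update x μ (x μ - ((((x μ - h).val % ℓ : ℕ)) : ZMod (P.sitesPerDir 0)))) + (1 - p ((x μ - h).val % ℓ)) * w (Function.update x μ (x μ - ((((x μ - h).val % ℓ : ℕ)) : ZMod (P.sitesPerDir 0)) + ((ℓ : ℕ) : ZMod (P.sitesPerDir 0))))) g ((List.finRange P.d).erase μ)) x = (List.foldr (fun (μ : Fin P.d) (w : Site P 0 → ℝ) (x : Site P 0) => p ((x μ - h).val % ℓ) * w (Function.update x μ (x μ - ((((x μ - h).val % ℓ : ℕ)) : ZMod (P.sitesPerDir 0)))) + (1 - p ((x μ - h).val % ℓ)) * w (Function.update x μ (x μ - ((((x μ - h).val % ℓ : ℕ)) : ZMod (P.sitesPerDir 0)) + ((ℓ : ℕ) : ZMod (P.sitesPerDir 0))))) g ((List.finRange P.d).erase μ)) (Function.update x μ (x μ - ((((x μ - h).val % ℓ : ℕ)) : ZMod (P.sitesPerDir 0)))) :=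
    fun x => runConst_foldr ℓ h p _ hμe g (hg μ) x
  -- the forward long difference of `F` at a point `y` is the fold of `δ⁺g` at `y`
  have hFdiff : ∀ y : Site P 0,
      (List.foldr (fun (μ : Fin P.d) (w : Site P 0 → ℝ) (x : Site P 0) => p ((x μ - h).val % ℓ) * w (Function.update x μ (x μ - ((((x μ - h).val % ℓ : ℕ)) : ZMod (P.sitesPerDir 0)))) + (1 - p ((x μ - h).val % ℓ)) * w (Function.update x μ (x μ - ((((x μ - h).val % ℓ : ℕ)) : ZMod (P.sitesPerDir 0)) + ((ℓ : ℕ) : ZMod (P.sitesPerDir 0))))) g ((List.finRange P.d).erase μ)) (Function.update y μ (y μ + ((ℓ : ℕ) : ZMod (P.sitesPerDir 0)))) - (List.foldr (fun (μ : Fin P.d) (w : Site P 0 → ℝ) (x : Site P 0) => p ((x μ - h).val % ℓ) * w (Function.update x μ (x μ - ((((x μ - h).val % ℓ : ℕ)) : ZMod (P.sitesPerDir 0)))) + (1 - p ((x μ - h).val % ℓ)) * w (Function.update x μ (x μ - ((((x μ - h).val % ℓ : ℕ)) : ZMod (P.sitesPerDir 0)) + ((ℓ : ℕ) : ZMod (P.sitesPerDir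 0))))) g ((List.finRange P.d).erase μ)) y = (List.foldr (fun (μ : Fin P.d) (w : Site P 0 → ℝ) (x : Site P 0) => p ((x μ - h).val % ℓ) * w (Function.update x μ (x μ - ((((x μ - h).val % ℓ : ℕ)) : ZMod (P.sitesPerDir 0)))) + (1 - p ((x μ - h).val % ℓ)) * w (Function.update x μ (x μ - ((((x μ - h).val % ℓ : ℕ)) : ZMod (P.sitesPerDir 0)) + ((ℓ : ℕ) : ZMod (P.sitesPerDir 0))))) (fun z => g (Function.update z μ (z μ + ((ℓ : ℕ) : ZMod (P.sitesPerDir 0)))) - g z) ((List.finRange P.d).erase μ)) y := by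
    intro y
    rw [foldr_translate ℓ h p _ μ hμe _ g y, ← foldr_sub]
  -- `x` is the forward `ℓ`-translate of `x − ℓe_μ`
  have hxm : ∀ x : Site P 0, Function.update (Function.update x μ (x μ - ((ℓ : ℕ) : ZMod (P.sitesPerDir 0)))) μ ((Function.update x μ (x μ - ((ℓ : ℕ) : ZMod (P.sitesPerDir 0)))) μ + ((ℓ : ℕ) : ZMod (P.sitesPerDir 0))) = x := by
    intro x
    rw [show (Function.update x μ (x μ - ((ℓ : ℕ) : ZMod (P.sitesPerDir 0)))) = Function.update x μ (x μ + -((ℓ : ℕ) : ZMod (P.sitesPerDir 0))) by rw [sub_eq_add_neg], update_update_add,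
      neg_add_cancel, add_zero, Function.update_eq_self]
  -- pointwise: `|Δ²_μΦ(x)| ≤ (6/ℓ²)(H'|δ⁺g|(x) + H'|δ⁺g|(x − ℓe_μ))`
  have hpt : ∀ x : Site P 0,
      |(List.foldr (fun (μ : Fin P.d) (w : Site P 0 → ℝ) (x : Site P 0) => p ((x μ - h).val % ℓ) * w (Function.update x μ (x μ - ((((x μ - h).val % ℓ : ℕ)) : ZMod (P.sitesPerDir 0)))) + (1 - p ((x μ - h).val % ℓ)) * w (Function.update x μ (x μ - ((((x μ - h).val % ℓ : ℕ)) : ZMod (P.sitesPerDir 0)) + ((ℓ : ℕ) : ZMod (P.sitesPerDir 0))))) g (List.finRange P.d)) (x.shift μ) - 2 * (List.foldr (fun (μ : Fin P.d) (w : Site P 0 → ℝ) (x : Site P 0) => p ((x μ - h).val % ℓ) * w (Function.update x μ (x μ - ((((x μ - h).val % ℓ : ℕ)) : ZMod (P.sitesPerDir 0)))) + (1 - p ((x μ - h).val % ℓ)) * w (Function.update x μ (x μ - ((((x μ - h).val % ℓ : ℕ)) : ZMod (P.sitesPerDir 0)) + ((ℓ : ℕ) : ZMod (P.sitesPerDir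 0))))) g (List.finRange P.d)) x + (List.foldr (fun (μ : Fin P.d) (w : Site P 0 → ℝ) (x : Site P 0) => p ((x μ - h).val % ℓ) * w (Function.update x μ (x μ - ((((x μ - h).val % ℓ : ℕ)) : ZMod (P.sitesPerDir 0)))) + (1 - p ((x μ - h).val % ℓ)) * w (Function.update x μ (x μ - ((((x μ - h).val % ℓ : ℕ)) : ZMod (P.sitesPerDir 0)) + ((ℓ : ℕ) : ZMod (P.sitesPerDir 0))))) g (List.finRange P.d)) (x.unshift μ)|
        ≤ 6 / (ℓ : ℝ) ^ 2 * ((List.foldr (fun (μ : Fin P.d) (w : Site P 0 → ℝ) (x : Site P 0) => p ((x μ - h).val % ℓ) * w (Function.update x μ (x μ - ((((x μ - h).val % ℓ : ℕ)) : ZMod (P.sitesPerDir 0)))) + (1 - p ((x μ - h).val % ℓ)) * w (Function.update x μ (x μ - ((((x μ - h).val % ℓ : ℕ)) : ZMod (P.sitesPerDir 0)) + ((ℓ : ℕ) : ZMod (P.sitesPerDir 0))))) (fun z => |(fun z => g (Function.update z μ (z μ + ((ℓ : ℕ) : ZMod (P.sitesPerDir 0)))) - g z) z|) ((List.finRange P.d).erase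 μ)) x + (List.foldr (fun (μ : Fin P.d) (w : Site P 0 → ℝ) (x : Site P 0) => p ((x μ - h).val % ℓ) * w (Function.update x μ (x μ - ((((x μ - h).val % ℓ : ℕ)) : ZMod (P.sitesPerDir 0)))) + (1 - p ((x μ - h).val % ℓ)) * w (Function.update x μ (x μ - ((((x μ - h).val % ℓ : ℕ)) : ZMod (P.sitesPerDir 0)) + ((ℓ : ℕ) : ZMod (P.sitesPerDir 0))))) (fun z => |(fun z => g (Function.update z μ (z μ + ((ℓ : ℕ) : ZMod (P.sitesPerDir 0)))) - g z) z|) ((List.finRange P.d).erase μ)) (Function.update x μ (x μ - ((ℓ : ℕ) : ZMod (P.sitesPerDir 0))))) := by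
    intro x
    rw [foldr_eq_hermStep_erase ℓ h p _ hnd μ hμ g (x.shift μ), foldr_eq_hermStep_erase ℓ h p _ hnd μ hμ g x,
      foldr_eq_hermStep_erase ℓ h p _ hnd μ hμ g (x.unshift μ)]
    refine (abs_secondDiff_hermStep_le ℓ h p hℓN hℓ hp0 hpℓ hpD hpc hpk0 hpk μ _ hF x).trans ?_
    refine mul_le_mul_of_nonneg_left (add_le_add ?_ ?_) (by positivity)
    · rw [hFdiff x]; exact foldr_abs_le ℓ h p hp01 hℓ _ _ x
    · have e := hFdiff (Function.update x μ (x μ - ((ℓ : ℕ) : ZMod (P.sitesPerDir 0))))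
      rw [hxm x] at e
      rw [e]; exact foldr_abs_le ℓ h p hp01 hℓ _ _ (Function.update x μ (x μ - ((ℓ : ℕ) : ZMod (P.sitesPerDir 0))))
  -- square, Jensen, and `(a + b)² ≤ 2a² + 2b²`
  have hsq : ∀ x : Site P 0,
      ((List.foldr (fun (μ : Fin P.d) (w : Site P 0 → ℝ) (x : Site P 0) => p ((x μ - h).val % ℓ) * w (Function.update x μ (x μ - ((((x μ - h).val % ℓ : ℕ)) : ZMod (P.sitesPerDir 0)))) + (1 - p ((x μ - h).val % ℓ)) * w (Function.update x μ (x μ - ((((x μ - h).val % ℓ : ℕ)) : ZMod (P.sitesPerDir 0)) + ((ℓ : ℕ) : ZMod (P.sitesPerDir 0))))) g (List.finRange P.d)) (x.shift μ) - 2 * (List.foldr (fun (μ : Fin P.d) (w : Site P 0 → ℝ) (x : Site P 0) => p ((x μ - h).val % ℓ) * w (Function.update x μ (x μ - ((((x μ - h).val % ℓ : ℕ)) : ZMod (P.sitesPerDir 0)))) + (1 - p ((x μ - h).val % ℓ)) * w (Function.update x μ (x μ - ((((x μ - h).val % ℓ : ℕ)) : ZMod (P.sitesPerDir 0)) + ((ℓ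 : ℕ) : ZMod (P.sitesPerDir 0))))) g (List.finRange P.d)) x + (List.foldr (fun (μ : Fin P.d) (w : Site P 0 → ℝ) (x : Site P 0) => p ((x μ - h).val % ℓ) * w (Function.update x μ (x μ - ((((x μ - h).val % ℓ : ℕ)) : ZMod (P.sitesPerDir 0)))) + (1 - p ((x μ - h).val % ℓ)) * w (Function.update x μ (x μ - ((((x μ - h).val % ℓ : ℕ)) : ZMod (P.sitesPerDir 0)) + ((ℓ : ℕ) : ZMod (P.sitesPerDir 0))))) g (List.finRange P.d)) (x.unshift μ)) ^ 2
        ≤ 72 / (ℓ : ℝ) ^ 4 * ((List.foldr (fun (μ : Fin P.d) (w : Site P 0 → ℝ) (x : Site P 0) => p ((x μ - h).val % ℓ) * w (Function.update x μ (x μ - ((((x μ - h).val % ℓ : ℕ)) : ZMod (P.sitesPerDir 0)))) + (1 - p ((x μ - h).val % ℓ)) * w (Function.update x μ (x μ - ((((x μ - h).val % ℓ : ℕ)) : ZMod (P.sitesPerDir 0)) + ((ℓ : ℕ) : ZMod (P.sitesPerDir 0))))) (fun z => (fun z => g (Function.update z μ (z μ + ((ℓ : ℕ) : ZMod (P.sitesPerDir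 0)))) - g z) z ^ 2) ((List.finRange P.d).erase μ)) x + (List.foldr (fun (μ : Fin P.d) (w : Site P 0 → ℝ) (x : Site P 0) => p ((x μ - h).val % ℓ) * w (Function.update x μ (x μ - ((((x μ - h).val % ℓ : ℕ)) : ZMod (P.sitesPerDir 0)))) + (1 - p ((x μ - h).val % ℓ)) * w (Function.update x μ (x μ - ((((x μ - h).val % ℓ : ℕ)) : ZMod (P.sitesPerDir 0)) + ((ℓ : ℕ) : ZMod (P.sitesPerDir 0))))) (fun z => (fun z => g (Function.update z μ (z μ + ((ℓ : ℕ) : ZMod (P.sitesPerDir 0)))) - g z) z ^ 2) ((List.finRange P.d).erase μ)) (Function.update x μ (x μ - ((ℓ : ℕ) : ZMod (P.sitesPerDir 0))))) := by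
    intro x
    have h1 := hpt x
    have hA := foldr_sq_le ℓ h p hp01 hℓ ((List.finRange P.d).erase μ) (fun z => |(fun z => g (Function.update z μ (z μ + ((ℓ : ℕ) : ZMod (P.sitesPerDir 0)))) - g z) z|) x
    have hB := foldr_sq_le ℓ h p hp01 hℓ ((List.finRange P.d).erase μ) (fun z => |(fun z => g (Function.update z μ (z μ + ((ℓ : ℕ) : ZMod (P.sitesPerDir 0)))) - g z) z|) (Function.update x μ (x μ - ((ℓ : ℕ) : ZMod (P.sitesPerDir 0))))
    simp only [sq_abs] at hA hB
    have hA0 : 0 ≤ (List.foldr (fun (μ : Fin P.d) (w : Site P 0 → ℝ) (x : Site P 0) => p ((x μ - h).val % ℓ) * w (Function.update x μ (x μ - ((((x μ - h).val % ℓ : ℕ)) : ZMod (P.sitesPerDir 0)))) + (1 - p ((x μ - h).val % ℓ)) * w (Function.update x μ (x μ - ((((x μ - h).val % ℓ : ℕ)) : ZMod (P.sitesPerDir 0)) + ((ℓ : ℕ) : ZMod (P.sitesPerDir 0))))) (fun z => |(fun z => g (Function.update z μ (z μ + ((ℓ : ℕ) : ZMod (P.sitesPerDir 0)))) - g z) z|)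 ((List.finRange P.d).erase μ)) x :=
      le_trans (abs_nonneg _) (foldr_abs_le ℓ h p hp01 hℓ _ (fun z => g (Function.update z μ (z μ + ((ℓ : ℕ) : ZMod (P.sitesPerDir 0)))) - g z) x)
    have hB0 : 0 ≤ (List.foldr (fun (μ : Fin P.d) (w : Site P 0 → ℝ) (x : Site P 0) => p ((x μ - h).val % ℓ) * w (Function.update x μ (x μ - ((((x μ - h).val % ℓ : ℕ)) : ZMod (P.sitesPerDir 0)))) + (1 - p ((x μ - h).val % ℓ)) * w (Function.update x μ (x μ - ((((x μ - h).val % ℓ : ℕ)) : ZMod (P.sitesPerDir 0)) + ((ℓ : ℕ) : ZMod (P.sitesPerDir 0))))) (fun z => |(fun z => g (Function.update z μ (z μ + ((ℓ : ℕ) : ZMod (P.sitesPerDir 0)))) - g z) z|) ((List.finRange P.d).erase μ)) (Function.update x μ (x μ - ((ℓ : ℕ) : ZMod (P.sitesPerDir 0)))) :=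
      le_trans (abs_nonneg _) (foldr_abs_le ℓ h p hp01 hℓ _ (fun z => g (Function.update z μ (z μ + ((ℓ : ℕ) : ZMod (P.sitesPerDir 0)))) - g z) (Function.update x μ (x μ - ((ℓ : ℕ) : ZMod (P.sitesPerDir 0)))))
    obtain ⟨hlo, hhi⟩ := abs_le.mp h1
    have hS := sq_le_sq' hlo hhi
    have e72 : (6 / (ℓ : ℝ) ^ 2) ^ 2 * 2 = 72 / (ℓ : ℝ) ^ 4 := by field_simp; ring
    refine hS.trans ?_
    rw [mul_pow, ← e72, mul_assoc]
    refine mul_le_mul_of_nonneg_left ?_ (sq_nonneg _)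
    nlinarith [hA, hB, sq_nonneg ((List.foldr (fun (μ : Fin P.d) (w : Site P 0 → ℝ) (x : Site P 0) => p ((x μ - h).val % ℓ) * w (Function.update x μ (x μ - ((((x μ - h).val % ℓ : ℕ)) : ZMod (P.sitesPerDir 0)))) + (1 - p ((x μ - h).val % ℓ)) * w (Function.update x μ (x μ - ((((x μ - h).val % ℓ : ℕ)) : ZMod (P.sitesPerDir 0)) + ((ℓ : ℕ) : ZMod (P.sitesPerDir 0))))) (fun z => |(fun z => g (Function.update z μ (z μ + ((ℓ : ℕ) : ZMod (P.sitesPerDir 0)))) - g z) z|) ((List.finRange P.d).erase μ)) x - (List.foldr (fun (μ : Fin P.d) (w : Site P 0 → ℝ) (x : Site P 0) => p ((x μ - h).val % ℓ) * w (Function.update x μ (x μ - ((((x μ - h).val % ℓ : ℕ)) : ZMod (P.sitesPerDir 0)))) + (1 - p ((x μ - h).val % ℓ)) * w (Function.update x μ (x μ - ((((x μ - h).val % ℓ : ℕ)) : ZMod (P.sitesPerDir 0)) + ((ℓ : ℕ) : ZMod (P.sitesPerDir 0))))) (fun z => |(fun z => g (Function.update z μ (z μ + ((ℓ : ℕ)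 : ZMod (P.sitesPerDir 0)))) - g z) z|) ((List.finRange P.d).erase μ)) (Function.update x μ (x μ - ((ℓ : ℕ) : ZMod (P.sitesPerDir 0)))))]
  -- sum: translation invariance and exact mass preservation
  have hrun : ∀ ν ∈ (List.finRange P.d).erase μ, ∀ x : Site P 0,
      (fun z => (fun z => g (Function.update z μ (z μ + ((ℓ : ℕ) : ZMod (P.sitesPerDir 0)))) - g z) z ^ 2) x = (fun z => (fun z => g (Function.update z μ (z μ + ((ℓ : ℕ) : ZMod (P.sitesPerDir 0)))) - g z) z ^ 2) (Function.update x ν (x ν - ((((x ν - h).val % ℓ : ℕ)) : ZMod (P.sitesPerDir 0)))) := by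
    intro ν hν x
    have hμν : μ ≠ ν := fun e => hμe (e ▸ hν)
    exact runConst_pair ℓ h hμν g (hg ν) ((ℓ : ℕ) : ZMod (P.sitesPerDir 0)) (fun a b => (a - b) ^ 2) x
  have hmass := sum_foldr_eq ℓ h p hℓN ((List.finRange P.d).erase μ) hnde (fun z => (fun z => g (Function.update z μ (z μ + ((ℓ : ℕ) : ZMod (P.sitesPerDir 0)))) - g z) z ^ 2) hrun
  have htr : ∑ x : Site P 0, (List.foldr (fun (μ : Fin P.d) (w : Site P 0 → ℝ) (x : Site P 0) => p ((x μ - h).val % ℓ) * w (Function.update x μ (x μ - ((((x μ - h).val % ℓ : ℕ)) : ZMod (P.sitesPerDir 0)))) + (1 - p ((x μ - h).val % ℓ)) * w (Function.update x μ (x μ - ((((x μ - h).val % ℓ : ℕ)) : ZMod (P.sitesPerDir 0)) + ((ℓ : ℕ) : ZMod (P.sitesPerDir 0))))) (fun z => (fun z => g (Function.update z μ (z μ + ((ℓ : ℕ) : ZMod (P.sitesPerDir 0)))) - g z) z ^ 2) ((List.finRange P.d).erase μ)) (Function.update x μ (x μ - ((ℓ : ℕ) : ZMod (P.sitesPerDir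 0))))
      = ∑ x : Site P 0, (List.foldr (fun (μ : Fin P.d) (w : Site P 0 → ℝ) (x : Site P 0) => p ((x μ - h).val % ℓ) * w (Function.update x μ (x μ - ((((x μ - h).val % ℓ : ℕ)) : ZMod (P.sitesPerDir 0)))) + (1 - p ((x μ - h).val % ℓ)) * w (Function.update x μ (x μ - ((((x μ - h).val % ℓ : ℕ)) : ZMod (P.sitesPerDir 0)) + ((ℓ : ℕ) : ZMod (P.sitesPerDir 0))))) (fun z => (fun z => g (Function.update z μ (z μ + ((ℓ : ℕ) : ZMod (P.sitesPerDir 0)))) - g z) z ^ 2) ((List.finRange P.d).erase μ)) x := by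
    have := sum_translate μ (-((ℓ : ℕ) : ZMod (P.sitesPerDir 0))) (fun x => (List.foldr (fun (μ : Fin P.d) (w : Site P 0 → ℝ) (x : Site P 0) => p ((x μ - h).val % ℓ) * w (Function.update x μ (x μ - ((((x μ - h).val % ℓ : ℕ)) : ZMod (P.sitesPerDir 0)))) + (1 - p ((x μ - h).val % ℓ)) * w (Function.update x μ (x μ - ((((x μ - h).val % ℓ : ℕ)) : ZMod (P.sitesPerDir 0)) + ((ℓ : ℕ) : ZMod (P.sitesPerDir 0))))) (fun z => (fun z => g (Function.update z μ (z μ + ((ℓ : ℕ) : ZMod (P.sitesPerDir 0)))) - g z) z ^ 2) ((List.finRange P.d).erase μ)) x)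
    simp only [← sub_eq_add_neg] at this
    exact this
  calc ∑ x : Site P 0, ((List.foldr (fun (μ : Fin P.d) (w : Site P 0 → ℝ) (x : Site P 0) => p ((x μ - h).val % ℓ) * w (Function.update x μ (x μ - ((((x μ - h).val % ℓ : ℕ)) : ZMod (P.sitesPerDir 0)))) + (1 - p ((x μ - h).val % ℓ)) * w (Function.update x μ (x μ - ((((x μ - h).val % ℓ : ℕ)) : ZMod (P.sitesPerDir 0)) + ((ℓ : ℕ) : ZMod (P.sitesPerDir 0))))) g (List.finRange P.d)) (x.shift μ) - 2 * (List.foldr (fun (μ : Fin P.d) (w : Site P 0 → ℝ) (x : Site P 0) => p ((x μ - h).val % ℓ) * w (Function.update x μ (x μ - ((((x μ - h).val % ℓ : ℕ)) : ZMod (P.sitesPerDir 0)))) + (1 - p ((x μ - h).val % ℓ)) * w (Function.update x μ (x μ - ((((x μ - h).val % ℓ : ℕ)) : ZMod (P.sitesPerDir 0)) + ((ℓ : ℕ) : ZMod (P.sitesPerDir 0))))) g (List.finRange P.d)) x + (List.foldr (fun (μ : Fin P.d) (w : Site P 0 → ℝ) (x : Site P 0) => p ((x μ - h).val % ℓ)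 * w (Function.update x μ (x μ - ((((x μ - h).val % ℓ : ℕ)) : ZMod (P.sitesPerDir 0)))) + (1 - p ((x μ - h).val % ℓ)) * w (Function.update x μ (x μ - ((((x μ - h).val % ℓ : ℕ)) : ZMod (P.sitesPerDir 0)) + ((ℓ : ℕ) : ZMod (P.sitesPerDir 0))))) g (List.finRange P.d)) (x.unshift μ)) ^ 2
      ≤ ∑ x : Site P 0, 72 / (ℓ : ℝ) ^ 4 * ((List.foldr (fun (μ : Fin P.d) (w : Site P 0 → ℝ) (x : Site P 0) => p ((x μ - h).val % ℓ) * w (Function.update x μ (x μ - ((((x μ - h).val % ℓ : ℕ)) : ZMod (P.sitesPerDir 0)))) + (1 - p ((x μ - h).val % ℓ)) * w (Function.update x μ (x μ - ((((x μ - h).val % ℓ : ℕ)) : ZMod (P.sitesPerDir 0)) + ((ℓ : ℕ) : ZMod (P.sitesPerDir 0))))) (fun z => (fun z => g (Function.update z μ (z μ + ((ℓ : ℕ) : ZMod (P.sitesPerDir 0)))) - g z) z ^ 2) ((List.finRange P.d).erase μ)) x + (List.foldr (fun (μ : Fin P.d) (w : Site P 0 → ℝ) (x : Site P 0) => p ((x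 μ - h).val % ℓ) * w (Function.update x μ (x μ - ((((x μ - h).val % ℓ : ℕ)) : ZMod (P.sitesPerDir 0)))) + (1 - p ((x μ - h).val % ℓ)) * w (Function.update x μ (x μ - ((((x μ - h).val % ℓ : ℕ)) : ZMod (P.sitesPerDir 0)) + ((ℓ : ℕ) : ZMod (P.sitesPerDir 0))))) (fun z => (fun z => g (Function.update z μ (z μ + ((ℓ : ℕ) : ZMod (P.sitesPerDir 0)))) - g z) z ^ 2) ((List.finRange P.d).erase μ)) (Function.update x μ (x μ - ((ℓ : ℕ) : ZMod (P.sitesPerDir 0))))) :=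
        Finset.sum_le_sum fun x _ => hsq x
    _ = 72 / (ℓ : ℝ) ^ 4 * (∑ x : Site P 0, (fun z => g (Function.update z μ (z μ + ((ℓ : ℕ) : ZMod (P.sitesPerDir 0)))) - g z) x ^ 2 + ∑ x : Site P 0, (fun z => g (Function.update z μ (z μ + ((ℓ : ℕ) : ZMod (P.sitesPerDir 0)))) - g z) x ^ 2) := by
        rw [← Finset.mul_sum, Finset.sum_add_distrib, htr, hmass]
    _ = 144 / (ℓ : ℝ) ^ 4 * ∑ x : Site P 0, (g (Function.update x μ (x μ + ((ℓ : ℕ) : ZMod (P.sitesPerDir 0)))) - g x) ^ 2 := by ring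

end FoldDiff

end Summit.QuantumFields.YangMills.Theorems.Prop7HermiteSecondDiff

end
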